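import Summits.CriticalPhenomena.PercolationContinuityZ3.Theorems.PercNearOneGluingNoHeavyLowerTailGZGluing
import Literature.Probability.LatticeModels.RandomClusterRimWiring
import Literature.Probability.LatticeModels.RandomClusterFiniteVolumePressure
import HarnessLib

/-!
# Connectivity correlation inequalities for `φ_{w,q}`, every `q > 0` — file 10: series / parallel GLUING of two edge sets —
# terminal connectivity and the cluster count

Support file (`--supports stmt-CriticalPhenomena-4575`), FK sub-lane `prim-bschramm-fk-2` (gen 7) of the post-continuity
programme; builds on p205010 (kernel theorem, internal audit signed; external expert review pending).  No definitions, no named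
facts, no sorries; standard axioms.  Pure combinatorics of open configurations `ω₁ ⊆ E₁`, `ω₂ ⊆ E₂` on two edge sets whose edges
live on vertex sets `V₁`, `V₂` (the two parts of a two-terminal series–parallel composition, `…AllQSPDefs.lean`):

* SERIES (`V₁ ∩ V₂ ⊆ {m}`, `a ∉ V₂`, `b ∉ V₁`): `FK.reachable_series_iff` — `a ↔ b` in `ω₁ ∪ ω₂` iff `a ↔ m` in `ω₁` and
  `m ↔ b` in `ω₂`; `FK.clusterCount_series` — `k(ω₁ ∪ ω₂) + |V| = k(ω₁) + k(ω₂)`.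
* PARALLEL (`V₁ ∩ V₂ ⊆ {s, t}`, `s ≠ t`): `FK.reachable_parallel_iff` — `s ↔ t` in `ω₁ ∪ ω₂` iff in `ω₁` or in `ω₂`;
  `FK.clusterCount_parallel` — `k(ω₁ ∪ ω₂) + |V| = k(ω₁) + k(ω₂) + 1{s ↔ t in ω₁ and in ω₂}`.
Here `k = clusterCount · ∅` counts the open clusters on all of `V` (Grimmett 2006, (1.20)).  These are the identities behind the
composition rules of the two-terminal "connected / disconnected" partition functions `(C, D)` of a series–parallel network:
series `C = C₁C₂/q`, `D = (C₁D₂ + D₁C₂ + D₁D₂)/q`; parallel `C = (C₁D₂ + D₁C₂ + q C₁C₂)/q²`, `D = D₁D₂/q²`.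
Tools: the vertex-separator walk splitting `GZGluing.walk_split` and the rim-wiring count `clusterCount_union_add_eq` (the second
part acts on the first like the wiring of the interface when it joins the interface; a virtual edge `st` reduces the remaining
case to that one), with the one-edge counts `card_connectedComponent_sup_edge_*`.
[cite: Grimmett2006, §1.4 eq. (1.20) (p. 15); §3.8 (series/parallel laws, pp. 61–62)] [cite: Wagner2006, Thm. 5.8, §5.3]
-/

namespace Summit.CriticalPhenomena.PercolationContinuityZ3.Theorems

namespace FK

open SimpleGraph Literature.Probability.LatticeModels Literature.Probability.Percolation
open scoped Classical

variable {V : Type*}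

/-! ### Terminal connectivity across a series / parallel gluing -/

section Reach

variable {E₁ E₂ ω₁ ω₂ : Set (Sym2 V)} {V₁ V₂ : Set V}

/-- **Parallel gluing, terminals**: if the two parts meet only inside `{s, t}`, then `s ↔ t` in `ω₁ ∪ ω₂` iff `s ↔ t` inside
`ω₁` or inside `ω₂` (an `s–t` walk splits into interface-to-interface hops, each inside one part). [folklore] -/
theorem reachable_parallel_iff (h₁ : ∀ e ∈ E₁, ∀ z ∈ e, z ∈ V₁) (h₂ : ∀ e ∈ E₂, ∀ z ∈ e, z ∈ V₂) {s t : V}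
    (hS : V₁ ∩ V₂ ⊆ {s, t}) (hω₁ : ω₁ ⊆ E₁) (hω₂ : ω₂ ⊆ E₂) :
    (openGraph (ω₁ ∪ ω₂)).Reachable s t ↔ (openGraph ω₁).Reachable s t ∨ (openGraph ω₂).Reachable s t := by
  refine ⟨fun h => ?_, GZGluing.reachable_union_of_side⟩
  obtain ⟨p⟩ := h
  obtain ⟨s', hs'S, hside, hchain⟩ := GZGluing.walk_split h₁ h₂ hS hω₁ hω₂ p (by simp)
  -- the property "`u = s`, or `s ↔ t` inside one part" propagates along interface hops
  have hA : ∀ u v, u ∈ ({u | u = s ∨ ((openGraph ω₁).Reachable s t ∨ (openGraph ω₂).Reachable s t)} : Set V) →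
      (u ∈ ({s, t} : Set V) ∧ v ∈ ({s, t} : Set V) ∧ ((openGraph ω₁).Reachable u v ∨ (openGraph ω₂).Reachable u v)) →
      v ∈ ({u | u = s ∨ ((openGraph ω₁).Reachable s t ∨ (openGraph ω₂).Reachable s t)} : Set V) := by
    rintro u v hu ⟨-, hv, huv⟩
    rcases hv with rfl | rfl
    · exact Or.inl rfl
    · rcases hu with rfl | hu
      · exact Or.inr huv
      · exact Or.inr hu
  have hs' : s' ∈ ({u | u = s ∨ ((openGraph ω₁).Reachable s t ∨ (openGraph ω₂).Reachable s t)} : Set V) := by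
    rcases hs'S with rfl | rfl
    · exact Or.inl rfl
    · exact Or.inr hside
  rcases GZGluing.reflTransGen_mem hA hchain hs' with ht | ht
  · subst ht; exact Or.inl (Reachable.refl _)
  · exact ht

/-- **Series gluing, terminals**: if the two parts meet only in the middle terminal `m`, `a` is off the second part and `b` off
the first (`a, b ≠ m`, `a ≠ b`), then `a ↔ b` in `ω₁ ∪ ω₂` iff `a ↔ m` inside `ω₁` and `m ↔ b` inside `ω₂`. [folklore] -/
theorem reachable_series_iff (h₁ : ∀ e ∈ E₁, ∀ z ∈ e, z ∈ V₁) (h₂ : ∀ e ∈ E₂, ∀ z ∈ e, z ∈ V₂) {a m b : V}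
    (hS : V₁ ∩ V₂ ⊆ {m}) (hω₁ : ω₁ ⊆ E₁) (hω₂ : ω₂ ⊆ E₂) (haV₂ : a ∉ V₂) (hbV₁ : b ∉ V₁)
    (ham : a ≠ m) (hbm : b ≠ m) (hab : a ≠ b) :
    (openGraph (ω₁ ∪ ω₂)).Reachable a b ↔ (openGraph ω₁).Reachable a m ∧ (openGraph ω₂).Reachable m b := by
  constructor
  · rintro ⟨p⟩
    have hS' : V₁ ∩ V₂ ⊆ ({m, b} : Set V) := fun z hz => Or.inl (hS hz)
    obtain ⟨s', hs'S, hside, hchain⟩ := GZGluing.walk_split h₁ h₂ hS' hω₁ hω₂ p (by simp)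
    -- the first segment lies in `ω₁` and ends at `m`
    have h1 : (openGraph ω₁).Reachable a s' := by
      rcases hside with h | h
      · exact h
      · by_cases has : a = s'
        · subst has; exact Reachable.refl _
        · exact absurd (GZGluing.mem_of_reachable_ne h₂ hω₂ h has) haV₂
    have hs'm : s' = m := by
      rcases hs'S with h | h
      · exact h
      · subst h
        exact absurd (GZGluing.mem_of_reachable_ne h₁ hω₁ h1.symm (Ne.symm hab)) hbV₁
    subst hs'm
    refine ⟨h1, ?_⟩
    -- the hops from `m` to `b`: "`z = m` or `m ↔ z` inside `ω₂`" propagates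
    have hA : ∀ u v, u ∈ ({u | u = s' ∨ (openGraph ω₂).Reachable s' u} : Set V) →
        (u ∈ ({s', b} : Set V) ∧ v ∈ ({s', b} : Set V) ∧ ((openGraph ω₁).Reachable u v ∨ (openGraph ω₂).Reachable u v)) →
        v ∈ ({u | u = s' ∨ (openGraph ω₂).Reachable s' u} : Set V) := by
      rintro u v hu ⟨-, hv, huv⟩
      rcases hv with rfl | rfl
      · exact Or.inl rfl
      · rcases hu with rfl | hu
        · rcases huv with h | h
          · exact absurd (GZGluing.mem_of_reachable_ne h₁ hω₁ h.symm hbm) hbV₁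
          · exact Or.inr h
        · rcases huv with h | h
          · by_cases hub : u = v
            · subst hub; exact Or.inr hu
            · have hu1 : u ∈ V₁ := GZGluing.mem_of_reachable_ne h₁ hω₁ h hub
              have hv1 : v ∈ V₁ := GZGluing.mem_of_reachable_ne h₁ hω₁ h.symm (Ne.symm hub)
              exact absurd hv1 hbV₁
          · exact Or.inr (hu.trans h)
    rcases GZGluing.reflTransGen_mem hA hchain (Or.inl rfl) with hb | hb
    · exact absurd hb hbm
    · exact hb
  · rintro ⟨ham', hmb⟩
    exact (GZGluing.reachable_union_of_side (Or.inl ham')).trans (GZGluing.reachable_union_of_side (Or.inr hmb))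

end Reach

/-! ### Cluster counts -/

section Count

variable [Fintype V]

/-- The empty configuration has `|V|` clusters. [cite: Grimmett2006, §1.2] -/
theorem clusterCount_empty_card : clusterCount (∅ : BondConfig V) ∅ = Fintype.card V := by
  -- adapted from `clusterCount_coe_empty` (FKFreeLoopRepresentation.lean)
  unfold clusterCount
  rw [wired_empty, sup_bot_eq, openGraph, fromEdgeSet_empty, ← Nat.card_eq_fintype_card]
  refine Nat.card_congr ⟨ConnectedComponent.lift id fun u v w _ ↦ ?_, (⊥ : SimpleGraph V).connectedComponentMk,
    ?_, fun v ↦ ConnectedComponent.lift_mk⟩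
  · cases w with
    | nil => rfl
    | cons h _ => exact ((bot_adj _ _).1 h).elim
  · intro C
    induction C using ConnectedComponent.ind with
    | h v => rfl

omit [Fintype V] in
/-- Wiring a pair `{s, t}` is adding the edge `st`. [cite: Grimmett2006, §4.2] -/
theorem wired_pair (s t : V) : wired ({s, t} : Set V) = edge s t := by
  ext x y
  rw [wired_adj, edge_adj]
  simp only [Set.mem_insert_iff, Set.mem_singleton_iff]
  constructor
  · rintro ⟨hxy, hx | hx, hy | hy⟩ <;> subst hx <;> subst hy
    · exact absurd rfl hxy
    · exact ⟨Or.inl ⟨rfl, rfl⟩, hxy⟩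
    · exact ⟨Or.inr ⟨rfl, rfl⟩, hxy⟩
    · exact absurd rfl hxy
  · rintro ⟨⟨hx, hy⟩ | ⟨hx, hy⟩, hxy⟩
    · exact ⟨hxy, Or.inl hx, Or.inr hy⟩
    · exact ⟨hxy, Or.inr hx, Or.inl hy⟩

/-- **Wiring a pair** lowers the free cluster count by one exactly when the pair was not yet joined:
`k^{{s,t}}(ω) + 1{s ↮ t} = k(ω)`. [cite: Grimmett2006, §4.2, §1.2] -/
theorem clusterCount_pair_add (ω : BondConfig V) (s t : V) :
    clusterCount ω ({s, t} : Set V) + (if (openGraph ω).Reachable s t then 0 else 1) = clusterCount ω ∅ := by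
  unfold clusterCount
  rw [wired_pair, wired_empty, sup_bot_eq]
  split_ifs with h
  · rw [add_zero, card_connectedComponent_sup_edge_of_reachable _ h]
  · have h1 := card_connectedComponent_sup_edge_lt _ h
    have h2 := card_connectedComponent_le_sup_edge_add_one (openGraph ω) s t
    omega

/-- **Opening one more pair** `st` lowers the cluster count by one exactly when `s, t` were not yet joined:
`k(ω ∪ {st}) + 1{s ↮ t in ω} = k(ω)`. [cite: Grimmett2006, §1.2, Thm. (3.1)(a)] -/
theorem clusterCount_union_pair_add (ω : BondConfig V) (s t : V) :
    clusterCount (ω ∪ {s(s, t)}) ∅ + (if (openGraph ω).Reachable s t then 0 else 1) = clusterCount ω ∅ := by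
  unfold clusterCount
  have he : openGraph (ω ∪ {s(s, t)}) = openGraph ω ⊔ edge s t := by
    rw [openGraph, openGraph, fromEdgeSet_union]; rfl
  rw [he, wired_empty, sup_bot_eq, sup_bot_eq]
  split_ifs with h
  · rw [add_zero, card_connectedComponent_sup_edge_of_reachable _ h]
  · have h1 := card_connectedComponent_sup_edge_lt _ h
    have h2 := card_connectedComponent_le_sup_edge_add_one (openGraph ω) s t
    omega

variable {E₁ E₂ ω₁ ω₂ : Set (Sym2 V)} {V₁ V₂ : Set V}

/-- **Series gluing, cluster count**: if the two parts meet only in one vertex `m`, then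
`k(ω₁ ∪ ω₂) + |V| = k(ω₁) + k(ω₂)` (the rim-wiring identity `clusterCount_union_add_eq` with the rim `{m}`, whose wiring is
void). [cite: Grimmett2006, §1.4 eq. (1.20); §4.2 Lemma (4.13)] -/
theorem clusterCount_series (h₁ : ∀ e ∈ E₁, ∀ z ∈ e, z ∈ V₁) (h₂ : ∀ e ∈ E₂, ∀ z ∈ e, z ∈ V₂) {m : V}
    (hS : V₁ ∩ V₂ ⊆ {m}) (hω₁ : ω₁ ⊆ E₁) (hω₂ : ω₂ ⊆ E₂) :
    clusterCount (ω₁ ∪ ω₂) ∅ + Fintype.card V = clusterCount ω₁ ∅ + clusterCount ω₂ ∅ := by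
  have key := clusterCount_union_add_eq (Set.toFinite ω₁).toFinset ω₂ (W := {m}) (X := V₁)
    (fun e he x hx => h₁ e (hω₁ ((Set.Finite.mem_toFinset _).1 he)) x hx)
    (fun e he x hx hxV₁ => hS ⟨hxV₁, h₂ e (hω₂ he) x hx⟩)
    (fun x hx y hy => by
      rw [Set.mem_singleton_iff] at hx hy
      subst hx; subst hy; exact Reachable.refl _)
  rw [Set.Finite.coe_toFinset, clusterCount_singleton, clusterCount_singleton, clusterCount_empty_card] at key
  omega

/-- **Parallel gluing, cluster count**: if the two parts meet only inside `{s, t}` (`s ≠ t`), then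
`k(ω₁ ∪ ω₂) + |V| = k(ω₁) + k(ω₂) + 1{s ↔ t in ω₁ and in ω₂}`.  When one part joins `s` to `t` it acts on the other like the
wiring of `{s, t}` (`clusterCount_union_add_eq`); when neither does, add the virtual edge `st` to the second part and remove it
again by the one-edge count. [cite: Grimmett2006, §1.4 eq. (1.20); §4.2 Lemma (4.13); Thm. (3.1)(a)] -/
theorem clusterCount_parallel (h₁ : ∀ e ∈ E₁, ∀ z ∈ e, z ∈ V₁) (h₂ : ∀ e ∈ E₂, ∀ z ∈ e, z ∈ V₂) {s t : V}
    (hS : V₁ ∩ V₂ ⊆ {s, t}) (hω₁ : ω₁ ⊆ E₁) (hω₂ : ω₂ ⊆ E₂) (hst : s ≠ t) :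
    clusterCount (ω₁ ∪ ω₂) ∅ + Fintype.card V =
      clusterCount ω₁ ∅ + clusterCount ω₂ ∅ +
        (if (openGraph ω₁).Reachable s t ∧ (openGraph ω₂).Reachable s t then 1 else 0) := by
  -- the wired counts of the pair `{s, t}`
  have hp₁ := clusterCount_pair_add ω₁ s t
  have hp₂ := clusterCount_pair_add ω₂ s t
  have hp₀ := clusterCount_pair_add (∅ : BondConfig V) s t
  have h0 : ¬ (openGraph (∅ : BondConfig V)).Reachable s t := by
    intro h
    have : openGraph (∅ : BondConfig V) = ⊥ := by rw [openGraph, fromEdgeSet_empty]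
    rw [this, reachable_bot] at h
    exact hst h
  rw [if_neg h0, clusterCount_empty_card] at hp₀
  -- rim wiring when one part joins `s` to `t`
  have rim : ∀ {F₁ F₂ η₁ η₂ : Set (Sym2 V)} {W₁ W₂ : Set V}, (∀ e ∈ F₁, ∀ z ∈ e, z ∈ W₁) → (∀ e ∈ F₂, ∀ z ∈ e, z ∈ W₂) →
      W₁ ∩ W₂ ⊆ {s, t} → η₁ ⊆ F₁ → η₂ ⊆ F₂ → (openGraph η₂).Reachable s t →
      clusterCount (η₁ ∪ η₂) ∅ + clusterCount (∅ : BondConfig V) {s, t} = clusterCount η₂ ∅ + clusterCount η₁ {s, t} := by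
    intro F₁ F₂ η₁ η₂ W₁ W₂ g₁ g₂ gS gη₁ gη₂ hr
    have key := clusterCount_union_add_eq (Set.toFinite η₁).toFinset η₂ (W := {s, t}) (X := W₁)
      (fun e he x hx => g₁ e (gη₁ ((Set.Finite.mem_toFinset _).1 he)) x hx)
      (fun e he x hx hxW₁ => gS ⟨hxW₁, g₂ e (gη₂ he) x hx⟩)
      (fun x hx y hy => by
        simp only [Set.mem_insert_iff, Set.mem_singleton_iff] at hx hy
        rcases hx with rfl | rfl <;> rcases hy with rfl | rfl
        · exact Reachable.refl _
        · exact hr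
        · exact hr.symm
        · exact Reachable.refl _)
    rw [Set.Finite.coe_toFinset] at key
    exact key
  by_cases hr₂ : (openGraph ω₂).Reachable s t
  · have key := rim h₁ h₂ hS hω₁ hω₂ hr₂
    by_cases hr₁ : (openGraph ω₁).Reachable s t
    · rw [if_pos ⟨hr₁, hr₂⟩]; rw [if_pos hr₁] at hp₁; omega
    · rw [if_neg (fun h => hr₁ h.1)]; rw [if_neg hr₁] at hp₁; omega
  · rw [if_neg (fun h => hr₂ h.2)]
    rw [if_neg hr₂] at hp₂
    by_cases hr₁ : (openGraph ω₁).Reachable s t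
    · -- symmetric rim wiring, the first part joins `s` to `t`
      have hS' : V₂ ∩ V₁ ⊆ ({s, t} : Set V) := fun z hz => hS ⟨hz.2, hz.1⟩
      have key := rim h₂ h₁ hS' hω₂ hω₁ hr₁
      rw [Set.union_comm] at key
      rw [if_pos hr₁] at hp₁
      omega
    · -- neither part joins `s` to `t`: virtual edge `st` added to the second part
      rw [if_neg hr₁] at hp₁
      have h₂' : ∀ e ∈ E₂ ∪ {s(s, t)}, ∀ z ∈ e, z ∈ V₂ ∪ {s, t} := by
        rintro e (he | he) z hz
        · exact Or.inl (h₂ e he z hz)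
        · rw [Set.mem_singleton_iff] at he; subst he
          right
          rcases Sym2.mem_iff.1 hz with rfl | rfl
          · exact Or.inl rfl
          · exact Or.inr rfl
      have hS' : V₁ ∩ (V₂ ∪ {s, t}) ⊆ ({s, t} : Set V) := by
        rintro z ⟨hz1, hz2 | hz2⟩
        · exact hS ⟨hz1, hz2⟩
        · exact hz2
      have hrv : (openGraph (ω₂ ∪ {s(s, t)})).Reachable s t :=
        Adj.reachable ((openGraph_adj _ s t).2 ⟨Or.inr rfl, hst⟩)
      have key := rim h₁ h₂' hS' hω₁ (Set.union_subset_union_left _ hω₂) hrv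
      -- remove the virtual edge again
      have hu := clusterCount_union_pair_add (ω₁ ∪ ω₂) s t
      have hunion : ¬ (openGraph (ω₁ ∪ ω₂)).Reachable s t := by
        rw [reachable_parallel_iff h₁ h₂ hS hω₁ hω₂]
        rintro (h | h)
        · exact hr₁ h
        · exact hr₂ h
      rw [if_neg hunion, Set.union_assoc] at hu
      have hv := clusterCount_union_pair_add ω₂ s t
      rw [if_neg hr₂] at hv
      omega

end Count

end FK

end Summit.CriticalPhenomena.PercolationContinuityZ3.Theorems
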